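import Mathlib.MeasureTheory.Integral.Bochner.Basic
import Mathlib.MeasureTheory.Integral.IntervalIntegral.Basic
import Mathlib.MeasureTheory.Constructions.Pi
import Mathlib.MeasureTheory.Constructions.BorelSpace.Basic
import Mathlib.NumberTheory.ArithmeticFunction.Moebius
import Mathlib.Data.Nat.Totient
import Mathlib.Analysis.SpecialFunctions.Log.Basic
import Literature.NumberTheory.Sieve.SingularSeries
import Literature.NumberTheory.Sieve.LevelOfDistribution
import HarnessLib

-- provenance: harness21/H21/H21/Prelude/AntSieve/MaynardTao.lean @ d967f76 (interim HEAD d8f2665); M5 mechanical rewrite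
/-!
# Maynard–Tao multidimensional sieve weights and the functional `M_k`

Trunk: AntSieve (OUTLINE C15, notion `sieve_framework`, part 3).

We set up the variational quantities of the Maynard–Tao method for bounded gaps between primes
(J. Maynard, *Small gaps between primes*, Ann. of Math. 181 (2015) 383–413, §§2–4;
D. H. J. Polymath, *Variants of the Selberg sieve, and bounded intervals containing many primes*
(Polymath 8b), Res. Math. Sci. 1:12 (2014), §3):

* `maynardSimplex k = R_k = {t ∈ [0,1]^k | ∑ tᵢ ≤ 1}`, `maynardCube k = [0,1]^k`;
* `maynardI k F = I_k(F) = ∫_{R_k} F²`;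
* `maynardJ k m F = J_k^{(m)}(F) = ∫_{[0,1]^k} (∫₀¹ F(t₁,…,t_{m-1},u,t_{m+1},…,t_k) du)² dt`;
* `maynardFunctional k F = (∑ₘ J_k^{(m)}(F)) / I_k(F)` and `maynardM k = M_k`, its supremum over
  admissible `F` (`IsMaynardAdmissible`);
* `maynardWeight k F R W d = λ_{d₁,…,d_k}`, the sieve weights of Maynard 2015 Prop. 4.1.

Theorems (proofs `sorry`, all free of `sSup`): Maynard 2015 Prop. 4.3
(`exists_maynardFunctional_gt`), the Polymath 8b upper bound (`maynardFunctional_le`), and the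
main sieve-theoretic consequence, Maynard 2015 Prop. 4.2 with Thm 3.1's shape
(`frequently_card_primes_ge_of_maynardFunctional`).

## Design notes

* **Normalisation of `J_k^{(m)}` (checked against Maynard 2015, display before Prop. 4.1).** Maynard
  integrates `(∫₀¹ F dt_m)²` over the remaining `k − 1` unit coordinates. We integrate the same
  quantity, with `F` replaced by `1_{R_k} F` and the `m`-th coordinate overwritten via
  `Function.update`, over the *unit cube* `[0,1]^k`: the integrand is constant in `t m` and the fibre
  `[0,1]` has length exactly `1`, so by Fubini this equals Maynard's `(k−1)`-dimensional integral on
  the nose. (Integrating over the simplex `R_k` instead, as first suggested in the outline, would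
  weight the fibre by `1 − ∑_{i ≠ m} tᵢ` and does **not** reproduce `J_k^{(m)}`; we therefore use the
  cube.) `I_k` is the integral of `F²` over `R_k`, equal to Maynard's `∫_{[0,1]^k} F²` for `F`
  supported on `R_k`.
* **Admissible test functions.** Maynard asks for piecewise-differentiable `F` supported on `R_k`;
  Polymath 8b §3 takes square-integrable `F` (the supremum `M_k` is the same by density, and
  Prop. 4.2/Thm 3.1 hold in this generality, Polymath 8b §3, definition of `M_k` and the `DHL[k, m+1]`
  deduction). We follow
  Polymath 8b: `IsMaynardAdmissible k F` asks that `F` be measurable, supported in `R_k`,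
  square-integrable on `R_k`, with `I_k(F) > 0`.
* `maynardM k` is a bare `sSup` and may be a junk value (`0`) if the set is empty or unbounded; no
  theorem below is routed through it except the remark lemma `le_maynardM`, which carries an explicit
  `BddAbove` hypothesis.
* `PrimesHaveLevel θ` (from `LevelOfDistribution`) means level `x^{θ−ε}` for every `ε > 0`; since the
  hypothesis `2m/θ < M` of Prop. 4.2 is strict, this matches Maynard's Hypothesis 1 usage.
* Chen's switching principle and the `W`-trick are proof devices and are not defined here; `W`
  enters `maynardWeight` only as a parameter.
* Mathlib has `stdSimplex` (the *probability* simplex `∑ tᵢ = 1`), which is not `R_k`; nothing else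
  relevant (Moebius `ArithmeticFunction.moebius`, `Nat.totient`, `Set.indicator`, Bochner/interval
  integrals) is duplicated.
-/

noncomputable section

open MeasureTheory Finset Filter
open scoped BigOperators ArithmeticFunction.Moebius

namespace Literature.NumberTheory.Sieve

/-! ### The simplex, `I_k`, `J_k^{(m)}` and `M_k` -/

/-- The corner simplex `R_k = {t : Fin k → ℝ | 0 ≤ tᵢ, ∑ tᵢ ≤ 1}` on which Maynard's test functions
are supported (Maynard 2015 §2, before (2.2); Polymath 8b §3). Not Mathlib's `stdSimplex`
(which is `∑ tᵢ = 1`). [cite: Maynard2015, §2  before (2.2] -/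
def maynardSimplex (k : ℕ) : Set (Fin k → ℝ) :=
  {t | (∀ i, 0 ≤ t i) ∧ ∑ i, t i ≤ 1}

/-- The unit cube `[0,1]^k ⊆ ℝ^k`, the domain of integration in Maynard 2015 (definitions of `I_k`,
`J_k^{(m)}` before Prop. 4.1). [cite: Maynard2015, (definitions of  I_k    J_k^{(m] -/
def maynardCube (k : ℕ) : Set (Fin k → ℝ) :=
  Set.pi Set.univ fun _ => Set.Icc 0 1

/-- `R_k ⊆ [0,1]^k` (Maynard 2015 §2). [cite: Maynard2015, §2] -/
theorem maynardSimplex_subset_maynardCube (k : ℕ) : maynardSimplex k ⊆ maynardCube k := by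
  intro t ht
  refine fun i _ => ⟨ht.1 i, ?_⟩
  calc t i ≤ ∑ j, t j := Finset.single_le_sum (fun j _ => ht.1 j) (Finset.mem_univ i)
    _ ≤ 1 := ht.2

/-- `R_k` is closed (Maynard 2015 §2). [cite: Maynard2015, §2] -/
theorem isClosed_maynardSimplex (k : ℕ) : IsClosed (maynardSimplex k) := by
  have h1 : IsClosed {t : Fin k → ℝ | ∀ i, 0 ≤ t i} := by
    simpa only [Set.setOf_forall] using
      isClosed_iInter fun i => isClosed_le continuous_const (continuous_apply i)
  have h2 : IsClosed {t : Fin k → ℝ | ∑ i, t i ≤ 1} :=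
    isClosed_le (continuous_finsetSum _ fun i _ => continuous_apply i) continuous_const
  simpa [maynardSimplex, Set.setOf_and] using h1.inter h2

/-- `R_k` is Lebesgue measurable (Maynard 2015 §2). [cite: Maynard2015, §2] -/
theorem measurableSet_maynardSimplex (k : ℕ) : MeasurableSet (maynardSimplex k) :=
  (isClosed_maynardSimplex k).measurableSet

/-- `R_k` is compact (Maynard 2015 §2). [cite: Maynard2015, §2] -/
theorem isCompact_maynardSimplex (k : ℕ) : IsCompact (maynardSimplex k) :=
  (isCompact_univ_pi fun _ => isCompact_Icc).of_isClosed_subset (isClosed_maynardSimplex k)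
    (maynardSimplex_subset_maynardCube k)

/-- `I_k(F) = ∫_{R_k} F(t)² dt` (Maynard 2015, display before Prop. 4.1; Polymath 8b §3, `I(F)`).
For `F` supported on `R_k` this is Maynard's `∫₀¹⋯∫₀¹ F² dt₁⋯dt_k`. [cite: Maynard2015, display before Prop. 4.1] -/
def maynardI (k : ℕ) (F : (Fin k → ℝ) → ℝ) : ℝ :=
  ∫ t in maynardSimplex k, F t ^ 2

/-- `J_k^{(m)}(F) = ∫₀¹⋯∫₀¹ (∫₀¹ F(t₁,…,t_k) dt_m)² ∏_{i ≠ m} dtᵢ` (Maynard 2015, display before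
Prop. 4.1). Implemented as the integral over the unit cube `[0,1]^k` of
`t ↦ (∫₀¹ (1_{R_k} F)(t with tₘ := u) du)²`; the integrand does not depend on `t m` and the fibre has
length `1`, so this equals Maynard's `(k−1)`-fold integral exactly (see the module docstring). [cite: Maynard2015, display before Prop. 4.1] -/
def maynardJ (k : ℕ) (m : Fin k) (F : (Fin k → ℝ) → ℝ) : ℝ :=
  ∫ t in maynardCube k,
    (∫ u in (0 : ℝ)..1, (maynardSimplex k).indicator F (Function.update t m u)) ^ 2

/-- The Maynard functional `(∑_{m=1}^k J_k^{(m)}(F)) / I_k(F)` whose supremum is `M_k`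
(Maynard 2015 Prop. 4.1; Polymath 8b §3). Junk value `0` when `I_k(F) = 0`. [cite: Maynard2015, Prop. 4.1] -/
def maynardFunctional (k : ℕ) (F : (Fin k → ℝ) → ℝ) : ℝ :=
  (∑ m, maynardJ k m F) / maynardI k F

/-- Admissible test functions for `M_k`, in the square-integrable generality of Polymath 8b §3
(Maynard 2015 Prop. 4.1 uses piecewise-differentiable `F`; the supremum is unchanged): `F` is
measurable, vanishes off `R_k`, `F²` is integrable on `R_k`, and `I_k(F) > 0`. [cite: Maynard2015, Prop. 4.1 uses piecewise-differentiable] -/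
structure IsMaynardAdmissible (k : ℕ) (F : (Fin k → ℝ) → ℝ) : Prop where
  /-- `F` is (Borel/Lebesgue) measurable. -/
  measurable : Measurable F
  /-- `F` vanishes outside the simplex `R_k`. -/
  support_subset : Function.support F ⊆ maynardSimplex k
  /-- `F` is square-integrable on `R_k`. -/
  integrableOn_sq : IntegrableOn (fun t => F t ^ 2) (maynardSimplex k)
  /-- `I_k(F) > 0`, i.e. `F` is not a.e. zero. -/
  maynardI_pos : 0 < maynardI k F

/-- `M_k = sup_F (∑ₘ J_k^{(m)}(F)) / I_k(F)` over admissible `F` (Maynard 2015 Prop. 4.1;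
Polymath 8b §3). DEFINITION ONLY: a bare `sSup` over `ℝ`, hence the junk value `0` if the set were
empty or unbounded above; no theorem in this file is stated through `M_k` except the remark
`le_maynardM` under an explicit `BddAbove` hypothesis. [cite: Maynard2015, Prop. 4.1] -/
def maynardM (k : ℕ) : ℝ :=
  sSup {M | ∃ F, IsMaynardAdmissible k F ∧ M = maynardFunctional k F}

/-- Remark form of the definition of `M_k`: any admissible `F` gives a lower bound
`maynardFunctional k F ≤ M_k`, provided the defining set is bounded above (Polymath 8b §3; the
boundedness is the content of `maynardFunctional_le`). [folklore] -/
theorem le_maynardM {k : ℕ} {F : (Fin k → ℝ) → ℝ}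
    (hb : BddAbove {M | ∃ F, IsMaynardAdmissible k F ∧ M = maynardFunctional k F})
    (hF : IsMaynardAdmissible k F) : maynardFunctional k F ≤ maynardM k :=
  le_csSup hb ⟨F, hF, rfl⟩

/-! ### The sieve weights `λ_d` -/

/-- The Maynard–Tao sieve weights (Maynard 2015 Prop. 4.1, cf. (2.2)–(2.3)):
`λ_{d₁,…,d_k} = (∏ᵢ μ(dᵢ) dᵢ) ∑_{r : dᵢ ∣ rᵢ, (rᵢ, W) = 1 ∀ i} μ(∏ᵢ rᵢ)² / (∏ᵢ φ(rᵢ)) ·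
F(log r₁ / log R, …, log r_k / log R)`.
The sum is written as a `Finset` sum over `1 ≤ rᵢ ≤ ⌊R⌋`; since `F` is cut off to `R_k`, only
`∏ rᵢ ≤ R` contributes, so nothing is lost. Maynard's side condition "`λ_d = 0` unless
`(∏ dᵢ, W) = 1`" is automatic: `dᵢ ∣ rᵢ` and `(rᵢ, W) = 1` force `(dᵢ, W) = 1`. Here `R` is the sieve
level (`R = N^{θ/2−δ}`) and `W = ∏_{p ≤ D₀} p` the `W`-trick modulus, both parameters. [cite: Maynard2015, Prop. 4.1  cf. (2.2] -/
def maynardWeight (k : ℕ) (F : (Fin k → ℝ) → ℝ) (R : ℝ) (W : ℕ) (d : Fin k → ℕ) : ℝ :=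
  (∏ i, ((μ (d i) : ℤ) : ℝ) * (d i : ℝ)) *
    ∑ r ∈ (Fintype.piFinset fun _ : Fin k => Finset.Icc 1 ⌊R⌋₊).filter
        (fun r => ∀ i, d i ∣ r i ∧ Nat.Coprime (r i) W),
      ((μ (∏ i, r i) : ℤ) : ℝ) ^ 2 / (∏ i, (Nat.totient (r i) : ℝ)) *
        (maynardSimplex k).indicator F (fun i => Real.log (r i) / Real.log R)

/-- With `d = (1, …, 1)` the prefactor `∏ μ(dᵢ) dᵢ` is `1` (Maynard 2015 Prop. 4.1, normalisation
of `λ_{1,…,1}`). [cite: Maynard2015, Prop. 4.1  normalisation of  λ_{1 … 1}] -/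
theorem maynardWeight_one (k : ℕ) (F : (Fin k → ℝ) → ℝ) (R : ℝ) (W : ℕ) :
    maynardWeight k F R W (fun _ => 1) =
      ∑ r ∈ (Fintype.piFinset fun _ : Fin k => Finset.Icc 1 ⌊R⌋₊).filter
          (fun r => ∀ i, Nat.Coprime (r i) W),
        ((μ (∏ i, r i) : ℤ) : ℝ) ^ 2 / (∏ i, (Nat.totient (r i) : ℝ)) *
          (maynardSimplex k).indicator F (fun i => Real.log (r i) / Real.log R) := by
  simp [maynardWeight]

/-! ### Theorems (Maynard 2015 §4; Polymath 8b §3) -/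

/-- **Maynard 2015 Prop. 4.3 (2).** For all sufficiently large `k`,
`M_k > log k − 2 log log k − 2`; stated `sSup`-free as the existence of an admissible `F` with
`(∑ₘ J_k^{(m)}(F)) / I_k(F) > log k − 2 log log k − 2` (Maynard, Ann. of Math. 181 (2015),
Prop. 4.3, proved in §7). [cite: Maynard2015, Prop. 4.3 (2] -/
def exists_maynardFunctional_gt : Prop :=
  ∃ k₀ : ℕ, ∀ k ≥ k₀, ∃ F : (Fin k → ℝ) → ℝ, IsMaynardAdmissible k F ∧
      Real.log k - 2 * Real.log (Real.log k) - 2 < maynardFunctional k F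

/-- **Maynard 2015 Prop. 4.3 (1), first part.** `M_5 > 2`: there is an admissible `F` on `R_5` with
Maynard functional `> 2` (Maynard 2015 Prop. 4.3, proved in §7 by an explicit polynomial). [cite: Maynard2015, Prop. 4.3  proved in §7 by an explicit p] -/
def exists_two_lt_maynardFunctional_five : Prop :=
  ∃ F : (Fin 5 → ℝ) → ℝ, IsMaynardAdmissible 5 F ∧ 2 < maynardFunctional 5 F

/-- **Maynard 2015 Prop. 4.3 (1), second part.** `M_105 > 4`: there is an admissible `F` on `R_105`
with Maynard functional `> 4` (Maynard 2015 Prop. 4.3, proved in §7). [cite: Maynard2015, Prop. 4.3  proved in §7] -/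
def exists_four_lt_maynardFunctional : Prop :=
  ∃ F : (Fin 105 → ℝ) → ℝ, IsMaynardAdmissible 105 F ∧ 4 < maynardFunctional 105 F

/-- **Polymath 8b upper bound.** For `k ≥ 2` and every admissible `F`,
`(∑ₘ J_k^{(m)}(F)) / I_k(F) ≤ (k/(k−1)) log k`, i.e. `M_k ≤ k log k/(k−1)` (Polymath 8b,
Res. Math. Sci. 1:12 (2014), §3 (statement of the bounds on `M_k`) and §6 (proof)). In particular the
set defining `maynardM k` is bounded above. [cite: Polymath8b2014, §3 (bounds on M_k) and §6 (proof of the upper bound M_k ≤ k log k/(k−1))] -/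
def maynardFunctional_le : Prop :=
  ∀ {k : ℕ} (hk : 2 ≤ k) {F : (Fin k → ℝ) → ℝ} (hF : IsMaynardAdmissible k F),
    maynardFunctional k F ≤ (k : ℝ) / (k - 1) * Real.log k

/-- **Maynard 2015 Prop. 4.2 with the conclusion of Thm 3.1.** Let the primes have level of
distribution `θ > 0` (`PrimesHaveLevel θ`, i.e. level `x^{θ−ε}` for every `ε > 0`), let
`H = {h₁,…,h_k}` be an admissible `k`-tuple and let `F` be an admissible test function with
`(∑ₘ J_k^{(m)}(F)) / I_k(F) > 2m/θ`. Then for infinitely many `n` at least `m + 1` of the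
`n + hᵢ` are (positive) primes (Maynard, Ann. of Math. 181 (2015), Prop. 4.2 and the deduction of
Thm 3.1 in §4; Polymath 8b §3, `DHL[k, m+1]`). The strict inequality lets one pass from Maynard's
level `x^θ` to `x^{θ−ε}`. [cite: Maynard2015, Prop. 4.2 with the conclusion of Thm 3.1] -/
def frequently_card_primes_ge_of_maynardFunctional : Prop :=
  ∀ (θ : ℝ) (hθ0 : 0 < θ) (hθ : PrimesHaveLevel θ) (m k : ℕ) (F : (Fin k → ℝ) → ℝ) (hF : IsMaynardAdmissible k F) (hM : 2 * (m : ℝ) / θ < maynardFunctional k F) (H : Finset ℤ) (hH : IsAdmissibleTuple H) (hk : H.card = k),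
    ∃ᶠ n : ℕ in atTop,
      m + 1 ≤ #(H.filter fun h ↦ 0 < (n : ℤ) + h ∧ ((n : ℤ) + h).toNat.Prime)

end Literature.NumberTheory.Sieve
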